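import Literature.MathematicalPhysics.QuantumLattice.TorusInverseGapSum
import Literature.MathematicalPhysics.QuantumLattice.TorusShellCounting
import HarnessLib

/-!
# The inverse-gap sum away from the van Hove level is logarithmic

Family `hubbard` / topic `MathematicalPhysics/QuantumLattice`; companion of `TorusInverseGapSum.lean`
(uniform bound `Σ_{|ε-μ| ≥ e₀} 1/|ε-μ| ≤ 4L²/√e₀ + 4L/e₀`). For levels `μ ∈ [-4 + d₀, -d₀]`, i.e.
away from the van Hove level `0` and from the band bottom `-4` (the lower half band; the upper one
is symmetric), the linear shell count `#{|ε_L(k) - μ| < η} ≤ 4L(ηL/(2π√(d₀/8)) + 1)`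
(`card_torusShell_le`, `η ≤ d₀/2`) replaces the uniform `√η` count on the shells below `d₀/2`:

* `sum_inv_abs_sub_le_log`: for `0 < 8e₀ ≤ d₀ ≤ -μ`, `d₀ ≤ μ + 4`:
  `Σ_{k : |ε_L(k) - μ| ≥ e₀} 1/|ε_L(k) - μ| ≤ (8/√d₀)·L²·log(d₀/(2e₀)) + 12·L²/√d₀ + 6·L/e₀ + 32·L/d₀`.

Proof: 4-adic layer cake up to the first shell reaching `d₀/2` (`J ≤ log₄(d₀/(2e₀))` shells, each
contributing `(8/(π√(d₀/8))) L² + 4L/(e₀4^j)`), and the uniform bound of `TorusInverseGapSum.lean`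
for the tail `|ε - μ| ≥ d₀/8`. This is the `Σ_k 1/|ξ_k| = O(L² log(1/e₀))` of the BCS gap equation
at a regular Fermi level; it is the Cauchy–Schwarz weight of the logarithmic pairing-cost rate
(`FreeFermiGasPairingCostLog.lean`).

Sources: J. Bardeen, L. N. Cooper, J. R. Schrieffer, Phys. Rev. 108 (1957) 1175, §II (the pairing
logarithm); folklore lattice-point counting. No named facts, no definitions.

## Mathlib / tree search

Tree: `card_torusShell_le` (linear count off van Hove), `sum_inv_abs_sub_le` (uniform count),
`torusCooperSum_le_inv` (only the trivial upper bound `1/(2η)` of the normalised Cooper sum exists),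
`exists_log_le_torusCooperSum` (the matching LOWER bound). Mathlib: `Nat.find`, `Nat.find_spec`,
`Nat.find_min'`, `pow_unbounded_of_one_lt`, `Real.log_le_log`, `Real.log_pow`,
`Real.le_log_iff_exp_le`, `Real.exp_one_lt_d9`, `Real.pi_gt_three`, `geom_sum_Ico_le_of_lt_one`.
-/

noncomputable section

namespace Literature.MathematicalPhysics.QuantumLattice

open Finset Real Literature.Probability.LatticeModels

variable {L : ℕ} [NeZero L]

/-- `1 ≤ log 4` (`e < 4`). [folklore] -/
private theorem one_le_log_four : (1 : ℝ) ≤ Real.log 4 := by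
  rw [Real.le_log_iff_exp_le (by norm_num)]
  exact Real.exp_one_lt_d9.le.trans (by norm_num)

/-- `√d₀ ≤ π √(d₀/8)` (`π² ≥ 8`). [folklore] -/
private theorem sqrt_le_pi_mul_sqrt_div_eight {d₀ : ℝ} (hd : 0 ≤ d₀) :
    Real.sqrt d₀ ≤ π * Real.sqrt (d₀ / 8) := by
  have hπ := Real.pi_gt_three
  have h0 : 0 ≤ π * Real.sqrt (d₀ / 8) := by positivity
  have hsq : d₀ ≤ (π * Real.sqrt (d₀ / 8)) ^ 2 := by
    rw [mul_pow, Real.sq_sqrt (by positivity)]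
    have hπ2 : 9 ≤ π ^ 2 := by nlinarith
    nlinarith [mul_le_mul_of_nonneg_right hπ2 hd]
  calc Real.sqrt d₀ ≤ Real.sqrt ((π * Real.sqrt (d₀ / 8)) ^ 2) := Real.sqrt_le_sqrt hsq
    _ = π * Real.sqrt (d₀ / 8) := Real.sqrt_sq h0

/-- **Logarithmic inverse-gap sum away from the van Hove level.** For `μ ∈ [-4 + d₀, -d₀]` and a
window `0 < e₀ ≤ d₀/8`:
`Σ_{k : |ε_L(k) - μ| ≥ e₀} 1/|ε_L(k) - μ| ≤ (8/√d₀)·L²·log(d₀/(2e₀)) + 12·L²/√d₀ + 6·L/e₀ + 32·L/d₀`.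
Bardeen–Cooper–Schrieffer (1957) §II. [folklore] -/
theorem sum_inv_abs_sub_le_log {μ d₀ e₀ : ℝ} (hμ4 : d₀ ≤ μ + 4) (hμ0 : d₀ ≤ -μ) (he : 0 < e₀)
    (hed : 8 * e₀ ≤ d₀) :
    ∑ k ∈ Finset.univ.filter (fun k : TorusSite 2 L => e₀ ≤ |torusBand L k - μ|),
        1 / |torusBand L k - μ| ≤
      8 / Real.sqrt d₀ * (L : ℝ) ^ 2 * Real.log (d₀ / (2 * e₀)) + 12 * (L : ℝ) ^ 2 / Real.sqrt d₀ +
        6 * L / e₀ + 32 * L / d₀ := by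
  classical
  have hd : 0 < d₀ := lt_of_lt_of_le (by positivity) hed
  set s₀ : ℝ := Real.sqrt (d₀ / 8) with hs₀
  have hs₀0 : 0 < s₀ := Real.sqrt_pos.2 (by positivity)
  have hL0 : (0 : ℝ) ≤ L := Nat.cast_nonneg _
  have hLpos : (0 : ℝ) < L := Nat.cast_pos.2 (Nat.pos_of_ne_zero (NeZero.ne L))
  -- the number of 4-adic shells below `d₀/2`
  have hex : ∃ j : ℕ, d₀ / 2 < e₀ * 4 ^ (j + 1) := by
    obtain ⟨n, hn⟩ := pow_unbounded_of_one_lt (d₀ / (2 * e₀)) (by norm_num : (1 : ℝ) < 4)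
    refine ⟨n, ?_⟩
    rw [div_lt_iff₀ (by positivity)] at hn
    have h4 : (4 : ℝ) ^ n ≤ 4 ^ (n + 1) := pow_le_pow_right₀ (by norm_num) (Nat.le_succ n)
    nlinarith
  set J : ℕ := Nat.find hex with hJ
  have hJspec : d₀ / 2 < e₀ * 4 ^ (J + 1) := Nat.find_spec hex
  have hJmin : ∀ j, j < J → e₀ * 4 ^ (j + 1) ≤ d₀ / 2 := fun j hj => by
    have := Nat.find_min hex (hJ ▸ hj)
    push Not at this
    exact this
  have hJtail : d₀ / 8 < e₀ * 4 ^ J := by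
    rw [pow_succ] at hJspec
    linarith
  -- `J ≤ log (d₀/(2e₀))`
  have hJlog : (J : ℝ) ≤ Real.log (d₀ / (2 * e₀)) := by
    have harg : 1 ≤ d₀ / (2 * e₀) := by
      rw [le_div_iff₀ (by positivity)]
      linarith
    rcases Nat.eq_zero_or_pos J with hJ0 | hJpos
    · rw [hJ0, Nat.cast_zero]
      exact Real.log_nonneg harg
    · have hle : e₀ * 4 ^ ((J - 1) + 1) ≤ d₀ / 2 := hJmin (J - 1) (Nat.sub_lt hJpos one_pos)
      rw [Nat.sub_add_cancel hJpos] at hle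
      have h4J : (4 : ℝ) ^ J ≤ d₀ / (2 * e₀) := by
        rw [le_div_iff₀ (by positivity)]
        linarith
      have hlog := Real.log_le_log (by positivity) h4J
      rw [Real.log_pow] at hlog
      calc (J : ℝ) ≤ J * Real.log 4 := by
            have := one_le_log_four
            have hJ0 : (0 : ℝ) ≤ J := Nat.cast_nonneg _
            nlinarith
        _ ≤ Real.log (d₀ / (2 * e₀)) := hlog
  -- shells and tail
  set A : ℕ → Finset (TorusSite 2 L) := fun j => Finset.univ.filter fun k : TorusSite 2 L =>
      e₀ * 4 ^ j ≤ |torusBand L k - μ| ∧ |torusBand L k - μ| < e₀ * 4 ^ (j + 1) with hA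
  set T : Finset (TorusSite 2 L) := Finset.univ.filter fun k : TorusSite 2 L =>
      e₀ * 4 ^ J ≤ |torusBand L k - μ| with hT
  -- pointwise layer cake
  have hpt : ∀ k : TorusSite 2 L, e₀ ≤ |torusBand L k - μ| →
      1 / |torusBand L k - μ| ≤
        ∑ j ∈ Finset.range J, (if k ∈ A j then 1 / (e₀ * 4 ^ j) else 0) +
          (if k ∈ T then 1 / |torusBand L k - μ| else 0) := by
    intro k hk
    have hξ : 0 < |torusBand L k - μ| := lt_of_lt_of_le he hk
    have hterm0 : ∀ j ∈ Finset.range J, (0 : ℝ) ≤ if k ∈ A j then 1 / (e₀ * 4 ^ j) else 0 := by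
      intro j _
      split_ifs <;> positivity
    obtain ⟨j, hj1, hj2⟩ := exists_nat_pow_near (x := |torusBand L k - μ| / e₀) (y := (4 : ℝ))
      (by rwa [le_div_iff₀ he, one_mul]) (by norm_num)
    rw [le_div_iff₀ he] at hj1
    rw [div_lt_iff₀ he] at hj2
    by_cases hjJ : j < J
    · have hkA : k ∈ A j := by
        simp only [hA, Finset.mem_filter, Finset.mem_univ, true_and]
        exact ⟨by linarith, by linarith⟩
      have hle : 1 / |torusBand L k - μ| ≤ 1 / (e₀ * 4 ^ j) :=
        one_div_le_one_div_of_le (by positivity) (by linarith)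
      have hsingle : (if k ∈ A j then 1 / (e₀ * 4 ^ j) else 0 : ℝ) ≤
          ∑ j ∈ Finset.range J, (if k ∈ A j then 1 / (e₀ * 4 ^ j) else 0) :=
        Finset.single_le_sum hterm0 (Finset.mem_range.2 hjJ)
      rw [if_pos hkA] at hsingle
      have htail0 : (0 : ℝ) ≤ if k ∈ T then 1 / |torusBand L k - μ| else 0 := by
        split_ifs <;> positivity
      linarith
    · push Not at hjJ
      have h4 : (e₀ * 4 ^ J : ℝ) ≤ e₀ * 4 ^ j :=
        mul_le_mul_of_nonneg_left (pow_le_pow_right₀ (by norm_num) hjJ) he.le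
      have hkT : k ∈ T := by
        simp only [hT, Finset.mem_filter, Finset.mem_univ, true_and]
        linarith
      rw [if_pos hkT]
      have := Finset.sum_nonneg hterm0
      linarith
  -- the linear shell count on the shells below `d₀/2`
  have hA_card : ∀ j, j < J → ((A j).card : ℝ) ≤
      4 * (L * (e₀ * 4 ^ (j + 1) * L / (2 * π * s₀) + 1)) := by
    intro j hj
    have hsub : A j ⊆ Finset.univ.filter
        (fun k : TorusSite 2 L => |torusBand L k - μ| < e₀ * 4 ^ (j + 1)) := by
      intro k hk
      simp only [hA, Finset.mem_filter] at hk ⊢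
      exact ⟨hk.1, hk.2.2⟩
    have h1 : ((A j).card : ℝ) ≤ ((Finset.univ.filter
        (fun k : TorusSite 2 L => |torusBand L k - μ| < e₀ * 4 ^ (j + 1))).card : ℝ) := by
      exact_mod_cast Finset.card_le_card hsub
    exact h1.trans (card_torusShell_le hμ4 hμ0 (by positivity) (hJmin j hj))
  -- the tail by the uniform bound at the window `d₀/8`
  have hT_sum : ∑ k ∈ T, 1 / |torusBand L k - μ| ≤ 12 * (L : ℝ) ^ 2 / Real.sqrt d₀ + 32 * L / d₀ := by
    have hsub : T ⊆ Finset.univ.filter (fun k : TorusSite 2 L => d₀ / 8 ≤ |torusBand L k - μ|) := by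
      intro k hk
      simp only [hT, Finset.mem_filter, Finset.mem_univ, true_and] at hk ⊢
      linarith
    have h1 : ∑ k ∈ T, 1 / |torusBand L k - μ| ≤
        ∑ k ∈ Finset.univ.filter (fun k : TorusSite 2 L => d₀ / 8 ≤ |torusBand L k - μ|),
          1 / |torusBand L k - μ| :=
      Finset.sum_le_sum_of_subset_of_nonneg hsub fun k _ _ => by positivity
    have h2 := sum_inv_abs_sub_le (L := L) μ (show 0 < d₀ / 8 by positivity)
    have hsq : Real.sqrt (d₀ / 8) = Real.sqrt d₀ / Real.sqrt 8 := Real.sqrt_div' d₀ (by norm_num)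
    have hs8 : Real.sqrt 8 ≤ 3 := by
      rw [show (3 : ℝ) = Real.sqrt (3 ^ 2) from (Real.sqrt_sq (by norm_num)).symm]
      exact Real.sqrt_le_sqrt (by norm_num)
    have hsd : 0 < Real.sqrt d₀ := Real.sqrt_pos.2 hd
    have h3 : 4 * (L : ℝ) ^ 2 / Real.sqrt (d₀ / 8) ≤ 12 * (L : ℝ) ^ 2 / Real.sqrt d₀ := by
      rw [hsq, div_div_eq_mul_div]
      rw [div_le_div_iff₀ hsd hsd]
      have : 0 ≤ (L : ℝ) ^ 2 * Real.sqrt d₀ := by positivity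
      nlinarith
    have h4 : 4 * (L : ℝ) / (d₀ / 8) = 32 * L / d₀ := by
      field_simp
      ring
    linarith
  -- `8/(π s₀) ≤ 8/√d₀`
  have hD : 8 / (π * s₀) ≤ 8 / Real.sqrt d₀ :=
    div_le_div_of_nonneg_left (by norm_num) (Real.sqrt_pos.2 hd)
      (by rw [hs₀]; exact sqrt_le_pi_mul_sqrt_div_eight hd.le)
  -- sum the pointwise bound
  calc ∑ k ∈ Finset.univ.filter (fun k : TorusSite 2 L => e₀ ≤ |torusBand L k - μ|),
        1 / |torusBand L k - μ|
      ≤ ∑ k ∈ Finset.univ.filter (fun k : TorusSite 2 L => e₀ ≤ |torusBand L k - μ|),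
          (∑ j ∈ Finset.range J, (if k ∈ A j then 1 / (e₀ * 4 ^ j) else 0) +
            (if k ∈ T then 1 / |torusBand L k - μ| else 0)) :=
        Finset.sum_le_sum fun k hk => hpt k (Finset.mem_filter.1 hk).2
    _ ≤ ∑ k, (∑ j ∈ Finset.range J, (if k ∈ A j then 1 / (e₀ * 4 ^ j) else 0) +
            (if k ∈ T then 1 / |torusBand L k - μ| else 0)) := by
        apply Finset.sum_le_sum_of_subset_of_nonneg (Finset.filter_subset _ _)
        intro k _ _
        refine add_nonneg (Finset.sum_nonneg fun j _ => ?_) ?_ <;> split_ifs <;> positivity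
    _ = ∑ j ∈ Finset.range J, ((A j).card : ℝ) * (1 / (e₀ * 4 ^ j)) +
          ∑ k ∈ T, 1 / |torusBand L k - μ| := by
        rw [Finset.sum_add_distrib, Finset.sum_comm]
        congr 1
        · refine Finset.sum_congr rfl fun j _ => ?_
          rw [Finset.sum_ite_mem, Finset.univ_inter, Finset.sum_const, nsmul_eq_mul]
        · rw [Finset.sum_ite_mem, Finset.univ_inter]
    _ ≤ ∑ j ∈ Finset.range J, (8 / (π * s₀) * (L : ℝ) ^ 2 + 4 * L / e₀ * (1 / 4 : ℝ) ^ j) +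
          (12 * (L : ℝ) ^ 2 / Real.sqrt d₀ + 32 * L / d₀) := by
        refine add_le_add (Finset.sum_le_sum fun j hj => ?_) hT_sum
        have hj' : j < J := Finset.mem_range.1 hj
        have h := mul_le_mul_of_nonneg_right (hA_card j hj')
          (show (0 : ℝ) ≤ 1 / (e₀ * 4 ^ j) by positivity)
        refine h.trans (le_of_eq ?_)
        rw [pow_succ, _root_.one_div_pow]
        field_simp
        ring
    _ = 8 / (π * s₀) * (L : ℝ) ^ 2 * J + 4 * L / e₀ * ∑ j ∈ Finset.range J, (1 / 4 : ℝ) ^ j +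
          (12 * (L : ℝ) ^ 2 / Real.sqrt d₀ + 32 * L / d₀) := by
        rw [Finset.sum_add_distrib, Finset.sum_const, Finset.card_range, nsmul_eq_mul, ← Finset.mul_sum]
        ring
    _ ≤ 8 / Real.sqrt d₀ * (L : ℝ) ^ 2 * Real.log (d₀ / (2 * e₀)) + 12 * (L : ℝ) ^ 2 / Real.sqrt d₀ +
          6 * L / e₀ + 32 * L / d₀ := by
        have hg4 : ∑ j ∈ Finset.range J, (1 / 4 : ℝ) ^ j ≤ 4 / 3 := by
          have := geom_sum_Ico_le_of_lt_one (x := (1 / 4 : ℝ)) (m := 0) (n := J)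
            (by norm_num) (by norm_num)
          rw [Finset.range_eq_Ico]
          refine this.trans ?_
          norm_num
        have hL2 : (0 : ℝ) ≤ (L : ℝ) ^ 2 := by positivity
        have hJ0 : (0 : ℝ) ≤ J := Nat.cast_nonneg _
        have hD0 : 0 ≤ 8 / (π * s₀) := by positivity
        have h1 : 8 / (π * s₀) * (L : ℝ) ^ 2 * J ≤ 8 / Real.sqrt d₀ * (L : ℝ) ^ 2 * Real.log (d₀ / (2 * e₀)) :=
          calc 8 / (π * s₀) * (L : ℝ) ^ 2 * J ≤ 8 / Real.sqrt d₀ * (L : ℝ) ^ 2 * J :=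
                mul_le_mul_of_nonneg_right (mul_le_mul_of_nonneg_right hD hL2) hJ0
            _ ≤ 8 / Real.sqrt d₀ * (L : ℝ) ^ 2 * Real.log (d₀ / (2 * e₀)) :=
                mul_le_mul_of_nonneg_left hJlog (by positivity)
        have h2 : 4 * (L : ℝ) / e₀ * ∑ j ∈ Finset.range J, (1 / 4 : ℝ) ^ j ≤ 6 * L / e₀ := by
          have hb : 0 ≤ 4 * (L : ℝ) / e₀ := by positivity
          have := mul_le_mul_of_nonneg_left hg4 hb
          have e : 4 * (L : ℝ) / e₀ * (4 / 3) = (16 / 3) * (L / e₀) := by ring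
          have e' : 6 * (L : ℝ) / e₀ = 6 * (L / e₀) := by ring
          have : 0 ≤ (L : ℝ) / e₀ := by positivity
          linarith
        linarith

end Literature.MathematicalPhysics.QuantumLattice
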